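import Literature.Algebra.Module.SocleRadical
import Literature.Algebra.Module.CompositionMultiplicitySemisimple
import Mathlib.RingTheory.Artinian.Module
import Mathlib.RingTheory.Jacobson.Semiprimary
import HarnessLib

/-!
# The top `M / rad M` of an Artinian module is semisimple; occurrence in the socle ⟺ embedding, occurrence in the top ⟺ quotient
# (Berrick–Keating §4.1.13–4.1.17; Krause, Conventions «Socle», «Radical»)

Family `hodge`, lane `lit-hodgefound` (foundations library; seat `lit-hodgefound-p39`, generation 33, row g33-#12); topic
`Algebra/Module`, namespace `Literature.Algebra.Module.SocleRadical` (continued).  Sequel of `SocleRadical` (g33-#4: `socle R M`,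
`isSemisimpleModule_socle`, Mathlib's `Module.jacobson R M = rad M`, `compMult_socle_le`, `compMult_top_le`) and of
`CompositionMultiplicitySemisimple` (g33-#11: in a semisimple module a composition factor is a submodule and a quotient) over an
ARBITRARY ring `R`.  What is formalised: (i) the TOP `top M = M / rad M` of an Artinian module — in particular of a module of finite
length — is semisimple (Mathlib's `IsArtinian.isSemisimpleModule_iff_jacobson` at `rad (M / rad M) = 0`), and it is the largest
semisimple quotient (every map to a semisimple module kills `rad M`); dually the socle is the largest semisimple submodule; (ii) for `S`
simple and `M` of finite length, **`[soc M : S] ≥ 1 ⟺ S ↪ M`** and **`[top M : S] ≥ 1 ⟺ M ↠ S`** — the multiplicity of `S` in the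
socle / top detects the simple SUBMODULES / QUOTIENTS of `M` (Berrick–Keating §4.1.13: minimal submodules = irreducible submodules;
Lemma 4.1.14 / Thm. 4.1.17 (i) inside the semisimple modules `soc M`, `top M`).
Theorems only, 0 `sorry`, no named fact (net debt 0, D-0026).

## The sources

A. J. Berrick, M. E. Keating, *An Introduction to Rings and Modules* (2000) [BerrickKeating2000, §4.1.13, Lemma 4.1.14, Thm. 4.1.16,
Thm. 4.1.17 (i), Cor. 4.1.18]; H. Krause, *Homological Theory of Representations* (2021) [Krause2021, Conventions «Socle», «Radical»:
«The top of `X` is the quotient `top(X) = X / rad(X)`»]; A. W. Knapp, D. A. Vogan (1995) [KnappVogan1995, App. A §3 Cor. A.27].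

## What is formalised

* §1 `isSemisimpleModule_top` (`M` Artinian ⟹ `M / rad M` semisimple), `isSemisimpleModule_top_of_isFiniteLength`, `isSemisimpleModule_of_surjective`,
  `jacobson_le_ker_of_isSemisimpleModule` (maps to semisimple modules kill `rad M`), `isSemisimpleModule_quotient_iff_jacobson_le`
  (`M / N` semisimple ⟺ `rad M ≤ N`, `M` Artinian), `range_le_socle_of_isSemisimpleModule` (maps from semisimple modules land in `soc M`).
* §2 **`compMult_socle_pos_iff_exists_injective : 0 < [soc M : S] ↔ ∃ f : S →ₗ M, injective`** (`S` simple, `M` of finite length),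
  `compMult_socle_eq_zero_iff`, `compMult_socle_pos_of_injective`.
* §3 **`compMult_top_pos_iff_exists_surjective : 0 < [M / rad M : S] ↔ ∃ g : M →ₗ S, surjective`**, `compMult_top_eq_zero_iff`,
  `compMult_top_pos_of_surjective`.
* §4 `compMult_pos_of_compMult_socle_pos`, `compMult_pos_of_compMult_top_pos` (occurrence in the socle / top is occurrence in `M`),
  `compMult_socle_eq_of_isSemisimpleModule`, `compMult_top_eq_of_isSemisimpleModule`; Schur forms `compMult_socle/top_pos_iff_exists_ne_zero`.

## Mathlib / Literature search

Mathlib: `IsArtinian.isSemisimpleModule_iff_jacobson`, `Module.jacobson_quotient_jacobson`, `IsSemisimpleModule.jacobson_le_ker`,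
`Module.map_jacobson_le`, `Submodule.liftQ`, `Submodule.mapQ`, `isArtinian_of_quotient_of_artinian`, `LinearMap.injective_of_ne_zero` /
`surjective_of_ne_zero`; no statement `IsSemisimpleModule R (M ⧸ Module.jacobson R M)` (`rg "jacobson" SimpleModule Artinian` → only the
iff above).  Literature: g33-#4 `SocleRadical.*`, g33-#11 `JordanHoelder.exists_injective_of_compMult_pos` & co.

## References

* A. J. Berrick, M. E. Keating, *An Introduction to Rings and Modules with K-theory in view*, CUP (2000), §4.1.13–Cor. 4.1.18. [BerrickKeating2000]
* H. Krause, *Homological Theory of Representations*, Cambridge Stud. Adv. Math. 195 (2021), Conventions. [Krause2021]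
* A. W. Knapp, D. A. Vogan, *Cohomological Induction and Unitary Representations*, Princeton (1995), App. A §3. [KnappVogan1995]
-/

open Submodule

namespace Literature.Algebra.Module

namespace SocleRadical

variable {R : Type*} [Ring R] {M : Type*} [AddCommGroup M] [Module R M]
  {N : Type*} [AddCommGroup N] [Module R N]
  (S : Type*) [AddCommGroup S] [Module R S]

/-! ## §1 The top of an Artinian module is semisimple; universal properties of top and socle -/

variable (R M) in
/-- **The top `M / rad M` of an Artinian module is semisimple** (`rad (M / rad M) = 0` and an Artinian module with zero radical is
semisimple).  The same statement is proved, the same way, inside a summit tree as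
`Summit.Ventures.HodgeRepro2.T5ThetaFiniteLength.isSemisimpleModule_quotient_jacobson` (not importable from `Literature/`; restated
here for the library). [cite: Krause2021, Conventions «Radical»] [cite: BerrickKeating2000, Thm. 4.1.16, Cor. 4.1.18] -/
theorem isSemisimpleModule_top [IsArtinian R M] : IsSemisimpleModule R (M ⧸ Module.jacobson R M) :=
  (IsArtinian.isSemisimpleModule_iff_jacobson R (M ⧸ Module.jacobson R M)).mpr (Module.jacobson_quotient_jacobson R M)

/-- The top of a module of finite length is semisimple. [cite: Krause2021, Conventions «Radical»] [cite: BerrickKeating2000, Cor. 4.1.18] -/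
theorem isSemisimpleModule_top_of_isFiniteLength (hM : IsFiniteLength R M) : IsSemisimpleModule R (M ⧸ Module.jacobson R M) := by
  rw [isFiniteLength_iff_isNoetherian_isArtinian] at hM
  obtain ⟨_, _⟩ := hM
  exact isSemisimpleModule_top R M

/-- **Every homomorphism to a semisimple module kills the radical** (Mathlib's `IsSemisimpleModule.jacobson_le_ker`): the top is the
largest semisimple quotient. [cite: Krause2021, Conventions «Radical»] [cite: BerrickKeating2000, §4.1.13] -/
theorem jacobson_le_ker_of_isSemisimpleModule [IsSemisimpleModule R N] (g : M →ₗ[R] N) : Module.jacobson R M ≤ LinearMap.ker g :=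
  IsSemisimpleModule.jacobson_le_ker (f := g)

/-- Semisimplicity passes along surjections (a quotient of a semisimple module is semisimple). [cite: BerrickKeating2000, Thm. 4.1.17 (ii)] -/
theorem isSemisimpleModule_of_surjective [IsSemisimpleModule R M] (g : M →ₗ[R] N) (hg : Function.Surjective g) :
    IsSemisimpleModule R N :=
  IsSemisimpleModule.congr (g.quotKerEquivOfSurjective hg).symm

/-- `M / N` is semisimple iff `rad M ≤ N`, for `M` Artinian. [cite: Krause2021, Conventions «Radical»] [cite: BerrickKeating2000, Thm. 4.1.17 (ii)] -/
theorem isSemisimpleModule_quotient_iff_jacobson_le [IsArtinian R M] (N' : Submodule R M) :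
    IsSemisimpleModule R (M ⧸ N') ↔ Module.jacobson R M ≤ N' := by
  constructor
  · intro h
    have h1 := jacobson_le_ker_of_isSemisimpleModule N'.mkQ
    rwa [Submodule.ker_mkQ] at h1
  · intro h
    -- `M / N'` is a quotient of the semisimple `M / rad M`
    haveI := isSemisimpleModule_top R M
    have hle : Module.jacobson R M ≤ LinearMap.ker N'.mkQ := by rwa [Submodule.ker_mkQ]
    refine isSemisimpleModule_of_surjective ((Module.jacobson R M).liftQ N'.mkQ hle) fun x => ?_
    obtain ⟨m, rfl⟩ := N'.mkQ_surjective x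
    exact ⟨Submodule.Quotient.mk m, rfl⟩

/-- **Every homomorphism from a semisimple module lands in the socle**: the socle is the largest semisimple submodule.
[cite: Krause2021, Conventions «Socle»] [cite: BerrickKeating2000, §4.1.13] -/
theorem range_le_socle_of_isSemisimpleModule [IsSemisimpleModule R N] (f : N →ₗ[R] M) : LinearMap.range f ≤ socle R M := by
  haveI : IsSemisimpleModule R (LinearMap.range f) := IsSemisimpleModule.range f
  exact le_socle_of_isSemisimpleModule _

/-- In particular the image of a simple module lies in the socle. [cite: BerrickKeating2000, §4.1.13] -/
theorem range_le_socle_of_isSimpleModule [IsSimpleModule R S] (f : S →ₗ[R] M) : LinearMap.range f ≤ socle R M :=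
  range_le_socle_of_isSemisimpleModule f

/-! ## §2 Occurrence in the socle ⟺ embedding -/

/-- An embedded simple module is a composition factor of the socle: `S ↪ M` ⟹ `[soc M : S] ≥ 1`. [cite: BerrickKeating2000, §4.1.13] -/
theorem compMult_socle_pos_of_injective [IsSimpleModule R S] (hM : IsFiniteLength R M) (f : S →ₗ[R] M)
    (hf : Function.Injective f) : 0 < JordanHoelder.compMult R (socle R M) S := by
  haveI : IsSimpleModule R (LinearMap.range f) := IsSimpleModule.congr (LinearEquiv.ofInjective f hf).symm
  exact compMult_socle_pos_of_isSimpleModule_submodule S hM (LinearMap.range f) (LinearEquiv.ofInjective f hf).symm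

/-- **`[soc M : S] ≥ 1 ⟺ S` embeds in `M`**, for `S` simple and `M` of finite length (the socle is semisimple, so a composition factor
of it is a submodule of it). [cite: BerrickKeating2000, §4.1.13, Lemma 4.1.14, Thm. 4.1.17 (i)] [cite: Krause2021, Conventions «Socle»] -/
theorem compMult_socle_pos_iff_exists_injective [IsSimpleModule R S] (hM : IsFiniteLength R M) :
    0 < JordanHoelder.compMult R (socle R M) S ↔ ∃ f : S →ₗ[R] M, Function.Injective f := by
  refine ⟨fun h => ?_, fun ⟨f, hf⟩ => compMult_socle_pos_of_injective S hM f hf⟩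
  haveI := isSemisimpleModule_socle R M
  obtain ⟨f, hf⟩ := JordanHoelder.exists_injective_of_compMult_pos S h
  exact ⟨(socle R M).subtype ∘ₗ f, (Submodule.subtype_injective _).comp hf⟩

/-- `[soc M : S] = 0 ⟺` no embedding `S ↪ M`. [cite: BerrickKeating2000, §4.1.13] -/
theorem compMult_socle_eq_zero_iff [IsSimpleModule R S] (hM : IsFiniteLength R M) :
    JordanHoelder.compMult R (socle R M) S = 0 ↔ ∀ f : S →ₗ[R] M, ¬ Function.Injective f := by
  rw [← not_iff_not, ← Ne, ← Nat.pos_iff_ne_zero, compMult_socle_pos_iff_exists_injective S hM]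
  simp only [not_forall, not_not]

/-- Equivalently (Schur): `[soc M : S] ≥ 1 ⟺ Hom_R(S, M) ≠ 0`. [cite: BerrickKeating2000, §4.1.13] -/
theorem compMult_socle_pos_iff_exists_ne_zero [IsSimpleModule R S] (hM : IsFiniteLength R M) :
    0 < JordanHoelder.compMult R (socle R M) S ↔ ∃ f : S →ₗ[R] M, f ≠ 0 := by
  rw [compMult_socle_pos_iff_exists_injective S hM]
  refine ⟨fun ⟨f, hf⟩ => ⟨f, fun h0 => ?_⟩, fun ⟨f, hf⟩ => ⟨f, LinearMap.injective_of_ne_zero hf⟩⟩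
  haveI := IsSimpleModule.nontrivial R S
  obtain ⟨x, hx⟩ := exists_ne (0 : S)
  exact hx (hf (by rw [h0, LinearMap.zero_apply, LinearMap.zero_apply]))

/-! ## §3 Occurrence in the top ⟺ quotient -/

/-- A simple quotient of `M` is a composition factor of the top: `M ↠ S` ⟹ `[M / rad M : S] ≥ 1` (the surjection kills `rad M`).
[cite: Krause2021, Conventions «Radical»] [cite: BerrickKeating2000, §4.1.13] -/
theorem compMult_top_pos_of_surjective [IsSimpleModule R S] (hM : IsFiniteLength R M) (g : M →ₗ[R] S)
    (hg : Function.Surjective g) : 0 < JordanHoelder.compMult R (M ⧸ Module.jacobson R M) S := by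
  have hle : Module.jacobson R M ≤ LinearMap.ker g := jacobson_le_ker_of_isSemisimpleModule g
  have hsurj : Function.Surjective ((Module.jacobson R M).liftQ g hle) := by
    intro s
    obtain ⟨m, rfl⟩ := hg s
    exact ⟨Submodule.Quotient.mk m, by simp⟩
  exact JordanHoelder.compMult_pos_of_surjective S (JordanHoelder.isFiniteLength_quotient _ hM) _ hsurj

/-- **`[M / rad M : S] ≥ 1 ⟺ S` is a quotient of `M`**, for `S` simple and `M` of finite length (the top is semisimple, so a
composition factor of it is a quotient of it). [cite: Krause2021, Conventions «Radical»] [cite: BerrickKeating2000, Lemma 4.1.14, Thm. 4.1.17 (i)] -/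
theorem compMult_top_pos_iff_exists_surjective [IsSimpleModule R S] (hM : IsFiniteLength R M) :
    0 < JordanHoelder.compMult R (M ⧸ Module.jacobson R M) S ↔ ∃ g : M →ₗ[R] S, Function.Surjective g := by
  refine ⟨fun h => ?_, fun ⟨g, hg⟩ => compMult_top_pos_of_surjective S hM g hg⟩
  haveI := isSemisimpleModule_top_of_isFiniteLength hM
  obtain ⟨g, hg⟩ := JordanHoelder.exists_surjective_of_compMult_pos S h
  exact ⟨g ∘ₗ (Module.jacobson R M).mkQ, hg.comp (Submodule.mkQ_surjective _)⟩

/-- `[M / rad M : S] = 0 ⟺` no surjection `M ↠ S`. [cite: Krause2021, Conventions «Radical»] -/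
theorem compMult_top_eq_zero_iff [IsSimpleModule R S] (hM : IsFiniteLength R M) :
    JordanHoelder.compMult R (M ⧸ Module.jacobson R M) S = 0 ↔ ∀ g : M →ₗ[R] S, ¬ Function.Surjective g := by
  rw [← not_iff_not, ← Ne, ← Nat.pos_iff_ne_zero, compMult_top_pos_iff_exists_surjective S hM]
  simp only [not_forall, not_not]

/-- Equivalently (Schur): `[M / rad M : S] ≥ 1 ⟺ Hom_R(M, S) ≠ 0`. [cite: BerrickKeating2000, §4.1.13] -/
theorem compMult_top_pos_iff_exists_ne_zero [IsSimpleModule R S] (hM : IsFiniteLength R M) :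
    0 < JordanHoelder.compMult R (M ⧸ Module.jacobson R M) S ↔ ∃ g : M →ₗ[R] S, g ≠ 0 := by
  rw [compMult_top_pos_iff_exists_surjective S hM]
  refine ⟨fun ⟨g, hg⟩ => ⟨g, fun h0 => ?_⟩, fun ⟨g, hg⟩ => ⟨g, LinearMap.surjective_of_ne_zero hg⟩⟩
  haveI := IsSimpleModule.nontrivial R S
  obtain ⟨x, hx⟩ := exists_ne (0 : S)
  obtain ⟨m, rfl⟩ := hg x
  exact hx (by rw [h0, LinearMap.zero_apply])

/-! ## §4 Occurrence in the socle or in the top is occurrence in `M` -/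

/-- `[soc M : S] ≥ 1 ⟹ [M : S] ≥ 1`. [cite: BerrickKeating2000, Thm. 4.1.12 (ii)] -/
theorem compMult_pos_of_compMult_socle_pos (hM : IsFiniteLength R M) (h : 0 < JordanHoelder.compMult R (socle R M) S) :
    0 < JordanHoelder.compMult R M S :=
  lt_of_lt_of_le h (compMult_socle_le S hM)

/-- `[M / rad M : S] ≥ 1 ⟹ [M : S] ≥ 1`. [cite: BerrickKeating2000, Thm. 4.1.12 (ii)] -/
theorem compMult_pos_of_compMult_top_pos (hM : IsFiniteLength R M)
    (h : 0 < JordanHoelder.compMult R (M ⧸ Module.jacobson R M) S) : 0 < JordanHoelder.compMult R M S :=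
  lt_of_lt_of_le h (compMult_top_le S hM)

/-- For a SEMISIMPLE module of finite length the three multiplicities agree: `[soc M : S] = [M : S]` …
[cite: BerrickKeating2000, §4.1.13, Cor. 4.1.18] -/
theorem compMult_socle_eq_of_isSemisimpleModule [IsSemisimpleModule R M] :
    JordanHoelder.compMult R (socle R M) S = JordanHoelder.compMult R M S :=
  JordanHoelder.compMult_congr_left S ((LinearEquiv.ofEq _ _ (socle_eq_top R M)).trans Submodule.topEquiv)

/-- … and `[M / rad M : S] = [M : S]`. [cite: BerrickKeating2000, §4.1.13, Cor. 4.1.18] [cite: Krause2021, Conventions «Radical»] -/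
theorem compMult_top_eq_of_isSemisimpleModule [IsSemisimpleModule R M] :
    JordanHoelder.compMult R (M ⧸ Module.jacobson R M) S = JordanHoelder.compMult R M S :=
  JordanHoelder.compMult_congr_left S (Submodule.quotEquivOfEqBot _ (jacobson_eq_bot_of_isSemisimpleModule R M))

end SocleRadical

end Literature.Algebra.Module
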